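import Literature.AnabelianGeometry.SemiGraphs.TemperedOrigin
import Literature.AnabelianGeometry.SemiGraphs.TemperedCurveHyperbolicWitness
import Literature.AnabelianGeometry.SemiGraphs.TemperedAnabelianWitness
import HarnessLib

/-!
# [SemiAnbd] §6 over the ORIGIN certificate (FACT-LIST rows F-1704 – F-1708): schema verdicts and
# consistency instances for `TemperedOrigin.…Holds`

Mochizuki, *Semi-graphs of anabelioids*, Publ. RIMS **42** (2006) [SemiAnbd], §6: Lemma 6.1 (ii)(iii)
p. 69, Lemma 6.3 (ii)(iii) p. 70, Theorem 6.5 pp. 71–72, Theorem 6.6 p. 72.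
[cite: MochizukiSemiAnbd2006, §6 pp.69-72]

PROOF-ONLY companion (abc-iut cell, block F fact-proving wave, seat abc-iut-f-056 floating onto the
unseated F-TRANCHES tranches 174 / 173; no definition, no new named fact) of `TemperedOrigin.lean`
(abc-iut-L3 lineage, p405101; imported, never edited).  That file asserts the printed §6 results only for
data CERTIFIED by an origin `Ω : TemperedOrigin p` (`Ω.IsHyperbolicCurveOrigin X` = "`X` IS `π₁^temp` of a
hyperbolic curve over a finite extension of `ℚ_p`"), as the named facts

* F-1708 `TemperedDecompositionGroupsHolds Ω` (Thm 6.5 (i)(ii)(iv)), F-1704 `CuspidalAbsolutenessHolds Ω`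
  (Thm 6.5 (iii)), F-1706 `ProfiniteNormalizersHolds Ω` (Lem 6.1 (ii)(iii)), F-1707
  `ProfiniteOuterIsoLiftsHolds Ω` (Thm 6.6), F-1705 `DenseSubgroupsHolds Ω` (Lem 6.3 (ii)(iii)).

This file records their KERNEL STATUS AS TYPED:

1. SCHEMA VERDICTS (universal closure over all `Ω` — in particular the all-certifying one — is FALSE):
   * F-1708: `not_forall_temperedDecompositionGroupsHolds`.  Two independent witnesses: (a) the junk datum
     "`TemperedCurve.degenerate p` with TWO non-cuspidal closed points, both with `D_x = Π^temp = G_{ℚ_p}`"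
     violates Thm 6.5 (i) `DecompDeterminesPoint` (`not_decompDeterminesPoint_twoPoint`); (b) at the tree's
     non-degenerate toy `TemperedCurve.toyHyperbolic p` (abc-iut-w5-d040: `Π^temp = G_{ℚ_p} × Ẑ × P`, one
     cusp with `D = G_{ℚ_p} × Ẑ × 1`) Thm 6.5 (ii) `DecompCommensurablyTerminal` FAILS — `D` is normal of
     index `> 1`, so its commensurator is everything (`not_decompCommensurablyTerminal_toyHyperbolic`; this
     kernel-checks the prose claim in that file's docstring).
   * F-1704: `not_forall_cuspidalAbsolutenessHolds` — the identity `Π^temp ≅ Π^temp` between the toy (one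
     cusp) and the SAME group with NO closed points does not carry the toy's cuspidal decomposition group to
     a cuspidal decomposition group (`not_isoPreservesCuspidalDecomp_toy`).
2. CONSISTENCY INSTANCES (the typed predicates are satisfiable; NOT the intended case, in which
   `Π^temp ↪ Π̂` is a proper dense subgroup): F-1706 holds for every datum whose `Π^temp → Π̂` is
   surjective with closed image of `Δ^temp` (`profiniteNormalizers_of_surjective`), e.g. at
   `TemperedCurve.degenerate` and at the toy; F-1707 holds between the degenerate data
   (`profiniteOuterIsoLifts_degenerate`: `Π^temp = Π̂`, lift `β := α̂`).
3. NOT TOUCHED (recorded): the INSTANCE forms at certified data are the business of the L3 sub-DAGs —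
   `TemperedOrigin.profiniteNormalizersHolds_of_tower` / `_of_isTempered` (F-1706),
   `TemperedOrigin.profiniteOuterIsoLiftsHolds_of_tower` / `profiniteOuterIsoLiftsHolds_of` (F-1707),
   `TemperedOrigin.denseSubgroupsHolds_of_tower` (F-1705), all PROVED modulo named structural inputs
   (`IsTempered`, the virtually-free tower `htower₀`, `SpecializationIsoSystemHolds`); no universal-closure
   refutation is offered for F-1705 / F-1706 / F-1707 (it would need a genuine, non-surjective profinite
   completion `Π^temp ↪ Π̂` built in the tree).

HONEST FRAMING: a refuted universal closure over ABSTRACT data says only that the origin certificate is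
necessary; the rows stay consumable AT CERTIFIED `X` (by name, or through the reductions in 3.); nothing of
[SemiAnbd] is refuted or asserted; typed ≠ proved; no side taken on [IUTchIII] Cor. 3.12.
-/

noncomputable section

namespace Literature.AnabelianGeometry.SemiGraphs

open scoped Pointwise
open _root_.Topology

namespace TemperedCurve

variable {p : ℕ} [Fact p.Prime]

/-! ### F-1706 (Lem 6.1 (ii)(iii)): consistency instances -/

/-- Lem 6.1 (iii) as typed holds trivially whenever `Π^temp → Π̂` is SURJECTIVE (`N_{Π̂}(Π̂) = Π̂`) — the
degenerate regime `Π^temp = Π̂`, not the printed situation. [cite: MochizukiSemiAnbd2006, Lem 6.1(iii) p.69] -/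
theorem piTempNormallyTerminal_of_surjective (X : TemperedCurve p) (h : Function.Surjective X.toHat) :
    X.PiTempNormallyTerminal := by
  unfold PiTempNormallyTerminal
  rw [MonoidHom.range_eq_top.mpr h]
  exact Subgroup.normalizer_eq_top _

/-- Lem 6.1 (ii) as typed holds trivially whenever the image of `Δ^temp` in `Π̂` is CLOSED (then
`Δ_X = Δ^temp` and `N_{Δ_X}(Δ^temp_X) = Δ_X = Δ^temp_X`). [cite: MochizukiSemiAnbd2006, Lem 6.1(ii) p.69] -/
theorem deltaTempNormallyTerminal_of_isClosed (X : TemperedCurve p)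
    (h : IsClosed ((X.DeltaTemp.map X.toHat.toMonoidHom : Subgroup X.PiHat) : Set X.PiHat)) :
    X.DeltaTempNormallyTerminal := by
  unfold DeltaTempNormallyTerminal
  have htop : (X.DeltaTemp.map X.toHat.toMonoidHom).subgroupOf X.DeltaHat = ⊤ :=
    Subgroup.subgroupOf_eq_top.mpr (Subgroup.topologicalClosure_minimal _ le_rfl h)
  rw [htop]
  exact Subgroup.normalizer_eq_top _

/-- **F-1706, CONSISTENCY INSTANCE.**  Both clauses of `ProfiniteNormalizersHolds` hold for a datum whose
`Π^temp → Π̂` is surjective and maps `Δ^temp` onto a closed subgroup — e.g. any datum with `Π^temp = Π̂`.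
[cite: MochizukiSemiAnbd2006, Lem 6.1(ii)-(iii) p.69] -/
theorem profiniteNormalizers_of_surjective (X : TemperedCurve p) (h : Function.Surjective X.toHat)
    (hc : IsClosed ((X.DeltaTemp.map X.toHat.toMonoidHom : Subgroup X.PiHat) : Set X.PiHat)) :
    X.DeltaTempNormallyTerminal ∧ X.PiTempNormallyTerminal :=
  ⟨X.deltaTempNormallyTerminal_of_isClosed hc, X.piTempNormallyTerminal_of_surjective h⟩

/-- `Δ^temp = Ker(Π^temp → G_{ℚ_p})` is closed (`G_{ℚ_p}` is Hausdorff). [cite: MochizukiSemiAnbd2006, §6 p.69] -/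
theorem isClosed_deltaTemp (X : TemperedCurve p) : IsClosed (X.DeltaTemp : Set X.PiTemp) := by
  haveI : IsGalois ℚ_[p] (AlgebraicClosure ℚ_[p]) := {}
  haveI : T2Space (GQp p) := krullTopology_t2
  have h : (X.DeltaTemp : Set X.PiTemp) = X.aug ⁻¹' {1} := by
    ext x
    simp [DeltaTemp]
  rw [h]
  exact isClosed_singleton.preimage X.aug.continuous

/-- For a datum with `Π̂ := Π^temp` and `toHat = id` the image of `Δ^temp` is `Δ^temp = Ker(aug)`, closed.
[cite: MochizukiSemiAnbd2006, §6 p.69] -/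
theorem isClosed_map_deltaTemp_degenerate :
    IsClosed (((degenerate p).DeltaTemp.map (degenerate p).toHat.toMonoidHom :
      Subgroup (degenerate p).PiHat) : Set (degenerate p).PiHat) := by
  have hmap : (degenerate p).DeltaTemp.map (degenerate p).toHat.toMonoidHom = (degenerate p).DeltaTemp :=
    Subgroup.map_id _
  rw [hmap]
  exact isClosed_deltaTemp (degenerate p)

/-- **F-1706 at `TemperedCurve.degenerate p`** (`Π^temp = Π̂ = G_{ℚ_p}`): both clauses hold.
[cite: MochizukiSemiAnbd2006, Lem 6.1(ii)-(iii) p.69] -/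
theorem profiniteNormalizers_degenerate :
    (degenerate p).DeltaTempNormallyTerminal ∧ (degenerate p).PiTempNormallyTerminal :=
  profiniteNormalizers_of_surjective _ Function.surjective_id (isClosed_map_deltaTemp_degenerate (p := p))

/-! ### F-1707 (Thm 6.6): consistency instance at the degenerate datum -/

/-- **F-1707, CONSISTENCY INSTANCE.**  Between the degenerate data (`Π^temp = Π̂ = G_{ℚ_p}`, `toHat = id`)
every isomorphism `α̂` of "profinite completions" lifts (by itself) and the lift is unique up to inner
automorphism (two lifts conjugate to `α̂` in `Π̂ = Π^temp` differ by an inner automorphism).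
[cite: MochizukiSemiAnbd2006, Thm 6.6 p.72] -/
theorem profiniteOuterIsoLifts_degenerate : (degenerate p).ProfiniteOuterIsoLifts (degenerate p) := by
  intro αhat
  refine ⟨⟨αhat, 1, fun g => ?_⟩, ?_⟩
  · simp only [one_mul, inv_one, mul_one]
    rfl
  rintro β β' ⟨c, hc⟩ ⟨c', hc'⟩
  refine ⟨c'⁻¹ * c, fun g => ?_⟩
  have e : c * (degenerate p).toHat (β g) * c⁻¹ = c' * (degenerate p).toHat (β' g) * c'⁻¹ :=
    (hc g).symm.trans (hc' g)
  -- `c β g c⁻¹ = c' β' g c'⁻¹` ⇒ `β' g = (c'⁻¹ c) β g (c'⁻¹ c)⁻¹` (in `Π̂ = Π^temp`)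
  have key : (degenerate p).toHat (β' g) =
      (c'⁻¹ * c) * (degenerate p).toHat (β g) * (c'⁻¹ * c)⁻¹ :=
    calc (degenerate p).toHat (β' g) = c'⁻¹ * (c' * (degenerate p).toHat (β' g) * c'⁻¹) * c' := by group
      _ = c'⁻¹ * (c * (degenerate p).toHat (β g) * c⁻¹) * c' := by rw [e]
      _ = (c'⁻¹ * c) * (degenerate p).toHat (β g) * (c'⁻¹ * c)⁻¹ := by group
  exact key

/-! ### F-1708 (Thm 6.5 (i)(ii)(iv)): the universal closure is false -/

/-- JUNK DATUM for Thm 6.5 (i): `TemperedCurve.degenerate p` (`Π^temp = G_{ℚ_p}`) but with TWO closed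
points, both non-cuspidal with decomposition group `Π^temp` itself (closed; surjects onto `G_{ℚ_p}`;
`I_x = Π^temp ∩ Δ^temp = 1`).  Not the datum of any curve. [cite: MochizukiSemiAnbd2006, Thm 6.5(i) p.71] -/
theorem exists_twoPoint :
    ∃ X : TemperedCurve p, ∃ x x' : X.Pt, x ≠ x' ∧ X.decomp x = ⊤ ∧ X.decomp x' = ⊤ := by
  refine ⟨{ degenerate p with
    Pt := Bool
    IsCusp := fun _ => False
    decomp := fun _ => ⊤
    isClosed_decomp := fun _ => ?_
    isOpen_aug_decomp := fun _ => ?_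
    inertia_eq_bot := fun _ _ => ?_
    inertia_equiv_zHat := fun _ h => h.elim }, true, false, fun h => Bool.noConfusion h, rfl, rfl⟩
  · change IsClosed (((⊤ : Subgroup (GQp p)) : Set (GQp p)))
    rw [Subgroup.coe_top]
    exact isClosed_univ
  · change IsOpen ((ContinuousMonoidHom.id (GQp p)) '' ((⊤ : Subgroup (GQp p)) : Set (GQp p)))
    simp
  · change (⊤ : Subgroup (GQp p)) ⊓ (ContinuousMonoidHom.id (GQp p)).toMonoidHom.ker = ⊥
    rw [top_inf_eq]
    exact (MonoidHom.ker_eq_bot_iff _).mpr Function.injective_id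

/-- Thm 6.5 (i) `DecompDeterminesPoint` FAILS at a datum with two distinct closed points sharing a
decomposition group. [cite: MochizukiSemiAnbd2006, Thm 6.5(i) p.71] -/
theorem not_decompDeterminesPoint_of_eq (X : TemperedCurve p) {x x' : X.Pt} (hne : x ≠ x')
    (h : X.decomp x = X.decomp x') : ¬ X.DecompDeterminesPoint := fun hX =>
  hne (hX x' x ⟨1, by rw [one_smul, h]⟩)

/-- Hence SOME datum of the interface violates Thm 6.5 (i) as typed.
[cite: MochizukiSemiAnbd2006, Thm 6.5(i) p.71] -/
theorem exists_not_decompDeterminesPoint : ∃ X : TemperedCurve p, ¬ X.DecompDeterminesPoint := by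
  obtain ⟨X, x, x', hne, hx, hx'⟩ := exists_twoPoint (p := p)
  exact ⟨X, X.not_decompDeterminesPoint_of_eq hne (hx.trans hx'.symm)⟩

/-- The toy's decomposition group `D = G_{ℚ_p} × Ẑ × 1` is NORMAL in `Π^temp = G_{ℚ_p} × Ẑ × P`.
[cite: MochizukiSemiAnbd2006, Thm 6.5(ii) p.71] -/
theorem toyDecomp_normal : (toyDecomp p).Normal := by
  unfold toyDecomp
  infer_instance

/-- … and PROPER: `P = ℤ_p ⋊ (1 + pℤ_p)` is not trivial (it is even nonabelian, `Iw_noncomm`).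
[cite: MochizukiSemiAnbd2006, Thm 6.5(ii) p.71] -/
theorem toyDecomp_ne_top : toyDecomp p ≠ ⊤ := by
  intro h
  have hall : ∀ u : Iw p, u = 1 := fun u => by
    have hu : ((1, (1, u)) : ToyPi p) ∈ toyDecomp p := by rw [h]; exact Subgroup.mem_top _
    exact (mem_toyDecomp_iff p _).1 hu
  exact Iw_noncomm p (by rw [hall ⟨0, 1⟩, hall ⟨1, 0⟩])

/-- **Thm 6.5 (ii) `DecompCommensurablyTerminal` FAILS at the toy** `TemperedCurve.toyHyperbolic p`: the
decomposition group `D` of its cusp is normal of index `> 1`, so `C_{Π^temp}(D) = Π^temp ≠ D`.  (Kernel check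
of the prose remark in `TemperedCurveHyperbolicWitness.lean`.) [cite: MochizukiSemiAnbd2006, Thm 6.5(ii) p.71] -/
theorem not_decompCommensurablyTerminal_toyHyperbolic : ¬ (toyHyperbolic p).DecompCommensurablyTerminal := by
  intro h
  have hD : Subgroup.Commensurable.commensurator (toyDecomp p) = toyDecomp p := h ()
  apply toyDecomp_ne_top (p := p)
  rw [← hD, eq_top_iff]
  intro g _
  rw [Subgroup.Commensurable.commensurator_mem_iff, (toyDecomp_normal (p := p)).conjAct]

/-- **FACT-LIST F-1708, universal closure REFUTED.**  At the all-certifying origin `Ω ≡ True` the typed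
Thm 6.5 (i)(ii)(iv) package fails (two independent witnesses: `exists_not_decompDeterminesPoint`,
`not_decompCommensurablyTerminal_toyHyperbolic`).  The row is consumable only at CERTIFIED data.
[cite: MochizukiSemiAnbd2006, Thm 6.5 pp.71-72] -/
theorem not_forall_temperedDecompositionGroupsHolds (p : ℕ) [Fact p.Prime] :
    ¬ ∀ Ω : TemperedOrigin p, Ω.TemperedDecompositionGroupsHolds := by
  intro h
  exact not_decompCommensurablyTerminal_toyHyperbolic (p := p)
    (h ⟨fun _ => True⟩ (toyHyperbolic p) trivial).2.2.1

/-! ### F-1704 (Thm 6.5 (iii)): the universal closure is false -/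

/-- The toy's chosen `D` IS a cuspidal decomposition group of the toy.
[cite: MochizukiSemiAnbd2006, Thm 6.5(iii) p.72] -/
theorem toyHyperbolic_isCuspidalDecompositionGroup :
    (toyHyperbolic p).IsCuspidalDecompositionGroup (toyDecomp p) :=
  ⟨(), trivial, 1, (one_smul _ _).symm⟩

/-- JUNK PAIR for Thm 6.5 (iii): the toy's group `Π^temp = G_{ℚ_p} × Ẑ × P` carrying NO closed point is
again a datum of the interface, and the identity `Π^temp ≅ Π^temp` carries the toy's cuspidal
decomposition group to a subgroup that is NOT a cuspidal decomposition group there (there are none).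
[cite: MochizukiSemiAnbd2006, Thm 6.5(iii) p.72] -/
theorem exists_not_isoPreservesCuspidalDecomp :
    ∃ Y : TemperedCurve p, ¬ (toyHyperbolic p).IsoPreservesCuspidalDecomp Y := by
  let Y : TemperedCurve p :=
    { toyHyperbolic p with
      Pt := PEmpty
      IsCusp := fun x => x.elim
      decomp := fun x => x.elim
      isClosed_decomp := fun x => x.elim
      isOpen_aug_decomp := fun x => x.elim
      inertia_eq_bot := fun x => x.elim
      inertia_equiv_zHat := fun x => x.elim }
  refine ⟨Y, fun h => ?_⟩
  obtain ⟨x, -, -⟩ :=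
    (h (ContinuousMulEquiv.refl _) (toyDecomp p)).1 (toyHyperbolic_isCuspidalDecompositionGroup (p := p))
  exact x.elim

/-- **FACT-LIST F-1704, universal closure REFUTED.**  At the all-certifying origin `Ω ≡ True` the typed
Thm 6.5 (iii) fails (`exists_not_isoPreservesCuspidalDecomp`).  The row is consumable only at CERTIFIED
data (consumers: [EtTh] Thm 1.6 / Prop 1.8 files take `IsoPreservesCuspidalDecomp` BY NAME).
[cite: MochizukiSemiAnbd2006, Thm 6.5(iii) p.72] -/
theorem not_forall_cuspidalAbsolutenessHolds (p : ℕ) [Fact p.Prime] :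
    ¬ ∀ Ω : TemperedOrigin p, Ω.CuspidalAbsolutenessHolds := by
  intro h
  obtain ⟨Y, hY⟩ := exists_not_isoPreservesCuspidalDecomp (p := p)
  exact hY (h ⟨fun _ => True⟩ (toyHyperbolic p) Y trivial trivial)

/-! ### Packaging at an origin certifying only degenerate data (consistency of F-1706 / F-1707) -/

/-- **F-1706 / F-1707, CONSISTENCY.**  The origin certifying exactly `TemperedCurve.degenerate p`
satisfies `ProfiniteNormalizersHolds` and `ProfiniteOuterIsoLiftsHolds` (and, vacuously in the closed
points, `TemperedDecompositionGroupsHolds` and `CuspidalAbsolutenessHolds`): the four typed predicates are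
jointly satisfiable by a non-trivially-certifying origin.  Consistency evidence only.
[cite: MochizukiSemiAnbd2006, §6 pp.69-72] -/
theorem holds_at_degenerateOrigin :
    (⟨fun X => X = degenerate p⟩ : TemperedOrigin p).ProfiniteNormalizersHolds ∧
    (⟨fun X => X = degenerate p⟩ : TemperedOrigin p).ProfiniteOuterIsoLiftsHolds ∧
    (⟨fun X => X = degenerate p⟩ : TemperedOrigin p).TemperedDecompositionGroupsHolds ∧
    (⟨fun X => X = degenerate p⟩ : TemperedOrigin p).CuspidalAbsolutenessHolds := by
  refine ⟨?_, ?_, ?_, ?_⟩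
  · rintro X (rfl : X = degenerate p)
    exact profiniteNormalizers_degenerate
  · rintro X Y (rfl : X = degenerate p) (rfl : Y = degenerate p)
    exact profiniteOuterIsoLifts_degenerate
  · rintro X (rfl : X = degenerate p)
    refine ⟨fun x => x.elim, fun x => x.elim, fun x => x.elim, fun x => x.elim, fun x => x.elim⟩
  · rintro X Y (rfl : X = degenerate p) -
    intro α D
    exact ⟨fun ⟨x, _, _⟩ => x.elim, fun ⟨x, _, _⟩ => x.elim⟩

end TemperedCurve

end Literature.AnabelianGeometry.SemiGraphs

end
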